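import Summits.HodgeConjecture.HodgeConjecture.Theorems.VHCAbelianSchemesRoadSecantAnchorInhabitedDefs
import Summits.HodgeConjecture.HodgeConjecture.Theorems.VHCAbelianSchemesRoadPencilThrough
import Literature.AlgebraicGeometry.HodgeTheory.AlgebraicClassesHodgeTypeHolds
import HarnessLib

/-!
# Negative knowledge for crux `SemiregularSheafRepresentativesTwPrimeAtDiag` (road b02, rung `(6, 3)`) — the family-supply hypothesis `SecantAnchorWeilPencilSupply'` REDUCES TO ITS LEFSCHETZ LOCUS

research route conditional on HC_CM; not a corollary; Q11.4-sentence-2 already refuted in dim ≥ 3.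

Refuter lane (pub-hodge-ring2, seat `refute-markman`, gen 2), FACT-FREE, door-free. The hypothesis
`Ring2.SemiregularRepresentatives.SecantAnchorWeilPencilSupply'` (the `Ring2.Hypotheses`-kind input under which road b02 inhabits
the pinned secant-quotient anchor of its `(6, 3)` rung INSIDE regime 2) quantifies over every datum `(d, P, Y, ψ₀, q, h, γ)`; this file
records, as kernel-checked bookkeeping, WHERE its content lies:

* `secantAnchorWeilPencilSupply'_conclusion_of_not_mem_divisorClassesSpan` — at every datum whose class `γ` is NOT Lefschetz
  (`γ ∉ D³(Y) ⊗ ℂ = divisorClassesSpan Y.X 6 3`) the conclusion `γ ∈ exceptionalPencilClassesThrough 6 3 Y.X h` holds OUTRIGHT, by the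
  constant pencil `Y × 𝔸¹` (the tree's `mem_exceptionalPencilClassesThrough_of_not_mem_divisorClassesSpan`), using of the binders only
  `Y.dim = 6`, `IsPolarizationClass 6 Y.X h` (rational, `(1,1)` via `N¹ ⊆ Hdg`), `γ` rational of type `(3,3)`; the Weil-type binders
  (`ψ₀`, `q`, hyperbolicity, `γ ∉ ℂ·h³`, `q^*γ` a Weil class) are DECORATION there;
* `secantAnchorWeilPencilSupply'_iff_onLefschetzLocus` — hence the hypothesis is EQUIVALENT to its restriction to Lefschetz data
  (`γ ∈ divisorClassesSpan Y.X 6 3`), i.e. to the `B = D` points of Weil type — which is exactly where road b02 consumes it: at Markman's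
  anchors `Y_d = (X × X̂)/Ḡ` with `X = Pic²(C)`, `C` generic of genus 3, the served Weil class is Lefschetz (Hodge ring of `X × X̂`
  generated by divisors; [cite: Markman2025SecantWeil, Cor. 1.3.2]), so the hypothesis is NOT decoration at its use site;
* `not_secantAnchorWeilPencilSupply'_of_lefschetzRigidDatum` — and any counterexample is a Lefschetz datum at which NO cell-shaped pencil
  through `(Y, h)` continues `γ` exceptionally. On paper such a datum exists INSIDE the binders as typed (refuter report REFUTE-MARKMAN-G2,
  2026-08-27): `Y = P = J × Ĵ` for a genus-3 Jacobian `J` with `End J = ℤ` (Mumford–Tate group `GSp₆`), `ψ₀ = φ_d` (`d ≥ 2`), `h` the PRODUCT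
  principal polarisation `pr₁^*θ + pr₂^*θ̂` (ample, hyperbolic via `L ⊗ H¹`-Lagrangians, but `φ_d^*h = θ₁ + d²θ₂ ≠ d·h`), `γ` any rational
  `ℚ(φ_d)`-Weil class: every polarised family through `(Y, h)` keeping `γ` and `h` Hodge has generic Mumford–Tate group `GSp(H¹J) ⊗ 1`, along
  which `γ` is a fixed rational cubic in the three flat divisor classes — algebraic and Lefschetz on every fibre. The repair is the
  compatibility binder `ψ₀^*(q^*h) = d • q^*h` of [cite: vanGeemen1994HodgeAV, 5.3–5.5], available at the pinned anchor
  (`complexBetti_map_descendedWeilOperator_secantPolarizationClass`). Nothing here asserts a Theses statement; no axiom beyond Lean's three.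
-/

noncomputable section

open CategoryTheory CategoryTheory.Limits AlgebraicGeometry Topology

namespace Summit.HodgeConjecture.HodgeConjecture.Ring2.SemiregularRepresentatives

-- the cell's namespace repeats the summit name (`Summit.HodgeConjecture.HodgeConjecture…`), as in every `Ring2*` file
set_option linter.dupNamespace false

open Literature.AlgebraicGeometry Literature.AlgebraicGeometry.Motives
open Literature.AlgebraicGeometry.HodgeTheory
open Literature.AlgebraicTopology.SingularHomology
open Literature.Barriers.HodgeConjecture (divisorClassesSpan)

/-- **Off the Lefschetz locus the supply hypothesis holds outright (constant pencil).** For an abelian sixfold `Y`, a polarisation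
class `h` and a rational `(3,3)` class `γ ∉ divisorClassesSpan Y.X 6 3`: `γ ∈ exceptionalPencilClassesThrough 6 3 Y.X h` — the Weil-type
binders of `SecantAnchorWeilPencilSupply'` are not used. [cite: vanGeemen1994HodgeAV, §2.4] [cite: Hartshorne1977, II.3 (p. 89)] -/
theorem secantAnchorWeilPencilSupply'_conclusion_of_not_mem_divisorClassesSpan
    (Y : AbelianVariety ℂ) (hY : Y.dim = 6) (h : complexBetti Y.X 2) (γ : complexBetti Y.X (2 * 3))
    (hh : IsPolarizationClass 6 Y.X h) (hγQ : IsRationalClass γ) (hγH : IsOfHodgeType 6 Y.X (2 * 3) 3 3 γ)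
    (hγD : γ ∉ divisorClassesSpan Y.X 6 3) :
    γ ∈ exceptionalPencilClassesThrough 6 3 Y.X h :=
  mem_exceptionalPencilClassesThrough_of_not_mem_divisorClassesSpan Y.X ⟨Y, hY, ⟨Iso.refl _⟩⟩ h hh.isRationalClass
    (isOfHodgeType_of_mem_algebraicClasses_of_isSmoothProjective
      (hY ▸ AbelianVariety.isSmoothProjective_holds (A := Y)) 1 hh.mem_algebraicClasses)
    γ hγQ hγH hγD

/-- **`SecantAnchorWeilPencilSupply'` is equivalent to its restriction to LEFSCHETZ data** (`γ ∈ divisorClassesSpan Y.X 6 3`, the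
`B = D` points): off that locus it is the previous theorem. [cite: vanGeemen1994HodgeAV, §2.4 and Thm. 4.11] -/
theorem secantAnchorWeilPencilSupply'_iff_onLefschetzLocus :
    SecantAnchorWeilPencilSupply' ↔
    ∀ (d : ℕ) (P Y : AbelianVariety ℂ) (ψ₀ : P ⟶ P) (q : P ⟶ Y) (h : complexBetti Y.X 2) (γ : complexBetti Y.X (2 * 3)),
      0 < d → P.dim = 6 → Y.dim = 6 → ψ₀ ≫ ψ₀ = -(d • 𝟙 P) →
      (∀ k : ℕ, Function.Bijective (complexBetti.map q.hom.hom.hom k)) →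
      IsPolarizationClass 6 Y.X h →
      IsHyperbolicWeilType P ψ₀ 3 (complexBetti.map q.hom.hom.hom 2 h) →
      IsRationalClass γ → γ ∉ (ℂ ∙ cupPowTwo h 3) →
      complexBetti.map q.hom.hom.hom (2 * 3) γ ∈ weilClassesOf P ψ₀ 3 d →
      IsOfHodgeType 6 Y.X (2 * 3) 3 3 γ →
      γ ∈ divisorClassesSpan Y.X 6 3 →
      γ ∈ exceptionalPencilClassesThrough 6 3 Y.X h := by
  constructor
  · intro hS d P Y ψ₀ q h γ hd hP hY hψ hq hh hhyp hγQ hγh hγW hγH _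
    exact hS d P Y ψ₀ q h γ hd hP hY hψ hq hh hhyp hγQ hγh hγW hγH
  · intro hL d P Y ψ₀ q h γ hd hP hY hψ hq hh hhyp hγQ hγh hγW hγH
    by_cases hD : γ ∈ divisorClassesSpan Y.X 6 3
    · exact hL d P Y ψ₀ q h γ hd hP hY hψ hq hh hhyp hγQ hγh hγW hγH hD
    · exact secantAnchorWeilPencilSupply'_conclusion_of_not_mem_divisorClassesSpan Y hY h γ hh hγQ hγH hD

/-- **Any counterexample to `SecantAnchorWeilPencilSupply'` is a Lefschetz datum; conversely a datum inside the binders whose class is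
continued exceptionally by NO cell-shaped pencil through `(Y, h)` refutes it** — the shape of the refuter's paper witness
`(J × Ĵ, φ_d, pr₁^*θ + pr₂^*θ̂, γ)`, `d ≥ 2`, `End J = ℤ` (module docstring). The Lefschetz membership is then forced
(`secantAnchorWeilPencilSupply'_conclusion_of_not_mem_divisorClassesSpan`). [cite: vanGeemen1994HodgeAV, §2.4 and 5.3–5.5] -/
theorem not_secantAnchorWeilPencilSupply'_of_lefschetzRigidDatum
    (d : ℕ) (P Y : AbelianVariety ℂ) (ψ₀ : P ⟶ P) (q : P ⟶ Y) (h : complexBetti Y.X 2) (γ : complexBetti Y.X (2 * 3))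
    (hd : 0 < d) (hP : P.dim = 6) (hY : Y.dim = 6) (hψ : ψ₀ ≫ ψ₀ = -(d • 𝟙 P))
    (hq : ∀ k : ℕ, Function.Bijective (complexBetti.map q.hom.hom.hom k))
    (hh : IsPolarizationClass 6 Y.X h) (hhyp : IsHyperbolicWeilType P ψ₀ 3 (complexBetti.map q.hom.hom.hom 2 h))
    (hγQ : IsRationalClass γ) (hγh : γ ∉ (ℂ ∙ cupPowTwo h 3))
    (hγW : complexBetti.map q.hom.hom.hom (2 * 3) γ ∈ weilClassesOf P ψ₀ 3 d) (hγH : IsOfHodgeType 6 Y.X (2 * 3) 3 3 γ)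
    (hno : γ ∉ exceptionalPencilClassesThrough 6 3 Y.X h) :
    ¬ SecantAnchorWeilPencilSupply' ∧ γ ∈ divisorClassesSpan Y.X 6 3 :=
  ⟨fun hS ↦ hno (hS d P Y ψ₀ q h γ hd hP hY hψ hq hh hhyp hγQ hγh hγW hγH),
    by_contra fun hD ↦ hno (secantAnchorWeilPencilSupply'_conclusion_of_not_mem_divisorClassesSpan Y hY h γ hh hγQ hγH hD)⟩

end Summit.HodgeConjecture.HodgeConjecture.Ring2.SemiregularRepresentatives

end
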